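import Summits.AtomisticToContinuum.BoseEinsteinCondensation.Theses.BECVortexSheetPeierls
import Summits.AtomisticToContinuum.BoseEinsteinCondensation.Theorems.BECVortexSheetPeierlsVillainCurrentLROGlue
import Summits.AtomisticToContinuum.BoseEinsteinCondensation.Theorems.BECVortexSheetPeierlsSpatialVillainLROFromGS

/-!
# AtomisticToContinuum / BoseEinsteinCondensation — route `BECVortexSheetPeierls`, assembly

Settles the assembly item `stmt-AtomisticToContinuum-15366` of route
`route-AtomisticToContinuum-BECVortexSheetPeierls` (the restated form of the earlier assembly
`stmt-AtomisticToContinuum-13471`): the implication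
`HealingScaleTransfer → BoundaryTransferWeak → BoseEinsteinCondensation`.

The engine crux `VillainCurrentLRO` is no longer a hypothesis: it is a theorem of the tree,
`villainCurrentLRO_of_homogeneousVillainLRO homogeneousVillainLRO_of_garbanSpencer`
(Garban–Spencer long-range order of the Villain rotator on the 3-torus, worm representation,
AHPS/Ginibre monotonicity in the bond stiffnesses, and `SliceMonotonicity`). The assembly is the
route's deciding theorem `closes` with that engine supplied; the remaining composition is pure
logic: `HealingScaleTransfer` applied to the engine gives the periodic-BEC body for every repulsive
finite-range potential `v`, and `BoundaryTransferWeak` turns it into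
`∃ ρ₀ > 0, ∀ ρ ∈ (0, ρ₀), HasGroundStateBEC v ρ`, i.e. the sub-problem statement
`BoseEinsteinCondensation`.
-/

namespace Summit.AtomisticToContinuum.BoseEinsteinCondensation.Theorems

open Summit.AtomisticToContinuum.BoseEinsteinCondensation.Theses.BECVortexSheetPeierls

/-- Settles `stmt-AtomisticToContinuum-15366` (exact signature): the assembly of route
`BECVortexSheetPeierls`, i.e. its two open cruxes `HealingScaleTransfer` and `BoundaryTransferWeak`
imply the sub-problem statement `BoseEinsteinCondensation`. Proof: the deciding theorem `closes`
with the engine `VillainCurrentLRO` supplied by the landed ladder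
`villainCurrentLRO_of_homogeneousVillainLRO homogeneousVillainLRO_of_garbanSpencer`.
[cite: GarbanSpencer2022, Theorem 1.3 with Remark 1 and Remark 10] -/
theorem becVortexSheetPeierls_assembly_proof :
    Summit.AtomisticToContinuum.BoseEinsteinCondensation.Theses.BECVortexSheetPeierls.Assembly :=
  fun h₃ h₄ =>
    closes (villainCurrentLRO_of_homogeneousVillainLRO homogeneousVillainLRO_of_garbanSpencer) h₃ h₄

end Summit.AtomisticToContinuum.BoseEinsteinCondensation.Theorems
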